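import Literature.NumberTheory.GaloisRepresentations.ResidualGaloisRep
import HarnessLib

/-!
# Residual representations of `ρ : Γ_K → GL_n(ℚ̄_ℓ)` have open kernel (hence finite image)

Topic `Literature/NumberTheory/GaloisRepresentations`.  A *proofs* file: theorems only, no named
fact (D-0026).

For a continuous `ρ : Γ_K → GL_n(ℚ̄_ℓ)` (`FramedGaloisRep K (PadicAlgCl ℓ) n`) and a residual
representation `τ : Γ_K → GL_n(k)` of `ρ` in the sense of the tree
(`FramedGaloisRep.IsReductionOf ρ ι τ`: `τ = Q (ρ₀ mod 𝔪) Q⁻¹` for an integral model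
`ρ₀ : Γ_K → GL_n(ℤ̄_ℓ)`, `ρ₀ = P⁻¹ ρ P`, pushed along `ι : ℤ̄_ℓ/𝔪 → k`;
`FramedGaloisRep.IsResidualRepOf ρ ι τ`: a semisimplification of such a reduction, ACC+ §1
"the semi-simplification of its reduction"), the kernel of `τ` is OPEN in `Γ_K`
(`isOpen_ker_of_isReductionOf`, `isOpen_ker_of_isResidualRepOf`); as `Γ_K` is compact, `τ` then
has finite image and factors through a finite Galois group — the standing (usually tacit) input of
every application of the Chebotarev density theorem to `ρ̄` (e.g. ACC+ Thm. 6.1.1, proof,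
§6.5.12: "By the Chebotarev density theorem, we can find a place `v₀` … such that `ρ̄(Frob_{v₀})`
is scalar", via the tree's `infinite_setOf_prime_absNorm_frobenius_eq_of_not_mem_adjoinRootsOfUnity`
of `ChebotarevCosetCyclotomic.lean`, whose hypothesis is `IsOpen τ.ker`).

Proof (Deligne–Serre 1974, 6.12, as in the tree's `isOpen_ker_residualRep`,
`ResidualRepresentation.lean`): the maximal ideal `𝔪 = {|x| < 1}` of `ℤ̄_ℓ` is open in `ℚ̄_ℓ`
(`isOpen_setOf_mem_maximalIdeal_padicAlgClIntegers`: it is the open unit ball of the normed field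
`PadicAlgCl ℓ`), so `ker (ρ₀ mod 𝔪)` is open (`isOpen_ker_residualRep`, continuity of `ρ`); it is
contained in `ker τ₀` for the conjugate `τ₀ = Q (ρ₀ mod 𝔪) Q⁻¹` pushed along `ι`, and
`ker τ₀ ≤ ker τ` for a semisimplification `τ` of `τ₀` (third clause of `IsSemisimplificationOf`);
a subgroup containing an open subgroup is open (Mathlib `Subgroup.isOpen_mono`).

## References

* [DeligneSerreASENS1974] P. Deligne, J.-P. Serre, *Formes modulaires de poids 1*, Ann. Sci. ÉNS
  (4) 7 (1974), 6.12 (reduction of an `ℓ`-adic representation; finite image of `ρ̄`).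
* [ACCGHLNSTT2023] P. B. Allen et al., *Potential automorphy over CM fields*, Ann. of Math. (2)
  197 (2023), §1 (Notation: `ρ̄`), §6.5.12 (proof of Thm. 6.1.1, Chebotarev step).
* [DarmonDiamondTaylor1995] H. Darmon, F. Diamond, R. Taylor, *Fermat's Last Theorem* (1995),
  §2.1, p. 54 (reductions and integral models).
-/

noncomputable section

open IsLocalRing Field

namespace Literature.NumberTheory.GaloisRepresentations

universe u w

section PadicAlgCl

variable {ℓ : ℕ} [Fact ℓ.Prime]

/-- **The maximal ideal of `ℤ̄_ℓ` is open in `ℚ̄_ℓ`**: as a subset of `ℚ̄_ℓ = PadicAlgCl ℓ` it is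
the open unit ball `{x : |x| < 1}` (an element of the valuation ring `{|x| ≤ 1}` is a non-unit
iff `|x| < 1`). [folklore] -/
theorem isOpen_setOf_mem_maximalIdeal_padicAlgClIntegers :
    IsOpen {x : PadicAlgCl ℓ | ∃ h : x ∈ padicAlgClIntegers ℓ,
      (⟨x, h⟩ : padicAlgClIntegers ℓ) ∈ maximalIdeal (padicAlgClIntegers ℓ)} := by
  have hmemO : ∀ x : PadicAlgCl ℓ, x ∈ padicAlgClIntegers ℓ ↔ Valued.v x ≤ 1 := fun x =>
    Valuation.mem_valuationSubring_iff _ _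
  -- membership in `𝔪` is `|x| < 1`
  have hmax : ∀ x : padicAlgClIntegers ℓ,
      x ∈ maximalIdeal (padicAlgClIntegers ℓ) ↔ Valued.v (x : PadicAlgCl ℓ) < 1 := by
    intro x
    rw [IsLocalRing.mem_maximalIdeal, mem_nonunits_iff]
    have hx : Valued.v (x : PadicAlgCl ℓ) ≤ 1 := (hmemO _).mp x.2
    constructor
    · intro hnu
      refine lt_of_le_of_ne hx fun h1 => hnu ?_
      have hx0 : (x : PadicAlgCl ℓ) ≠ 0 := by
        intro h0
        rw [h0, map_zero] at h1
        exact zero_ne_one h1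
      have hinv : (x : PadicAlgCl ℓ)⁻¹ ∈ padicAlgClIntegers ℓ := by
        rw [hmemO, map_inv₀, h1, inv_one]
      exact isUnit_iff_exists_inv.mpr ⟨⟨_, hinv⟩, Subtype.ext (mul_inv_cancel₀ hx0)⟩
    · rintro hlt ⟨u, hu⟩
      have h1 : Valued.v ((u : padicAlgClIntegers ℓ) : PadicAlgCl ℓ) *
          Valued.v (((u⁻¹ : (padicAlgClIntegers ℓ)ˣ) : padicAlgClIntegers ℓ) : PadicAlgCl ℓ) =
            1 := by
        rw [← map_mul, ← Subring.coe_mul, ← Units.val_mul, mul_inv_cancel, Units.val_one,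
          OneMemClass.coe_one, map_one]
      have hle : Valued.v (((u⁻¹ : (padicAlgClIntegers ℓ)ˣ) : padicAlgClIntegers ℓ) :
          PadicAlgCl ℓ) ≤ 1 := (hmemO _).mp (u⁻¹ : (padicAlgClIntegers ℓ)ˣ).1.2
      rw [hu] at h1
      have : (1 : NNReal) < 1 := by
        calc (1 : NNReal) = _ := h1.symm
          _ ≤ Valued.v (x : PadicAlgCl ℓ) * 1 := mul_le_mul' le_rfl hle
          _ < 1 * 1 := by rw [mul_one, one_mul]; exact hlt
          _ = 1 := one_mul 1
      exact lt_irrefl _ this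
  have hset : {x : PadicAlgCl ℓ | ∃ h : x ∈ padicAlgClIntegers ℓ,
      (⟨x, h⟩ : padicAlgClIntegers ℓ) ∈ maximalIdeal (padicAlgClIntegers ℓ)} =
      Metric.ball (0 : PadicAlgCl ℓ) 1 := by
    ext x
    simp only [Set.mem_setOf_eq, Metric.mem_ball, dist_zero_right]
    constructor
    · rintro ⟨hx, hm⟩
      have h := (hmax ⟨x, hx⟩).mp hm
      rw [PadicAlgCl.valuation_def, ← NNReal.coe_lt_coe, coe_nnnorm, NNReal.coe_one] at h
      exact h
    · intro hx
      have h : Valued.v x < 1 := by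
        rw [PadicAlgCl.valuation_def, ← NNReal.coe_lt_coe, coe_nnnorm, NNReal.coe_one]
        exact hx
      exact ⟨(hmemO x).mpr h.le, (hmax _).mpr h⟩
  rw [hset]
  exact Metric.isOpen_ball

variable {K : Type u} [Field K] {n : ℕ} {k : Type w} [Field k]

namespace FramedGaloisRep

/-- **A reduction of a continuous `ρ : Γ_K → GL_n(ℚ̄_ℓ)` has open kernel** (Deligne–Serre 1974,
6.12).  If `τ = Q (ρ₀ mod 𝔪) Q⁻¹` (pushed along `ι : ℤ̄_ℓ/𝔪 → k`) for an integral model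
`ρ₀ = P⁻¹ ρ P : Γ_K → GL_n(ℤ̄_ℓ)` (`FramedGaloisRep.IsReductionOf`), then `ker τ` is open in `Γ_K`:
it contains `ker (ρ₀ mod 𝔪)`, which is open because `ρ` is continuous and `𝔪 ⊂ ℚ̄_ℓ` is open
(`isOpen_ker_residualRep`, `isOpen_setOf_mem_maximalIdeal_padicAlgClIntegers`).
[cite: DeligneSerreASENS1974, 6.12] -/
theorem isOpen_ker_of_isReductionOf {ρ : FramedGaloisRep K (PadicAlgCl ℓ) n}
    {ι : padicAlgClResidueField ℓ →+* k} {τ : absoluteGaloisGroup K →* GL (Fin n) k}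
    (h : ρ.IsReductionOf ι τ) : IsOpen (τ.ker : Set (absoluteGaloisGroup K)) := by
  obtain ⟨ρ₀, Q, ⟨P, hP⟩, hτ⟩ := h
  have hker₀ : IsOpen ((((Matrix.GeneralLinearGroup.map (residue (padicAlgClIntegers ℓ))).comp
      ρ₀).ker : Subgroup (absoluteGaloisGroup K)) : Set (absoluteGaloisGroup K)) :=
    isOpen_ker_residualRep isOpen_setOf_mem_maximalIdeal_padicAlgClIntegers hP
  refine Subgroup.isOpen_mono ?_ hker₀
  intro g hg
  rw [MonoidHom.mem_ker] at hg ⊢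
  have hred : integralReduction ι ρ₀ g = 1 := by
    change Matrix.GeneralLinearGroup.map (ι.comp (residue (padicAlgClIntegers ℓ))) (ρ₀ g) = 1
    rw [Matrix.GeneralLinearGroup.map_comp, MonoidHom.comp_apply]
    have hg' : Matrix.GeneralLinearGroup.map (residue (padicAlgClIntegers ℓ)) (ρ₀ g) = 1 := hg
    rw [hg', map_one]
  rw [hτ g, hred, mul_one, mul_inv_cancel]

/-- **A residual representation of a continuous `ρ : Γ_K → GL_n(ℚ̄_ℓ)` has open kernel** (ACC+
§1: `ρ̄` is "the semi-simplification of its reduction"; Deligne–Serre 1974, 6.12).  If `τ` is a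
semisimplification of a reduction `τ₀` of `ρ` (`FramedGaloisRep.IsResidualRepOf`), then
`ker τ ⊇ ker τ₀` (third clause of `IsSemisimplificationOf`) is open
(`isOpen_ker_of_isReductionOf`).  In particular `τ` has finite image (`Γ_K` is compact) and the
Chebotarev density theorem applies to the finite extension it cuts out (tree:
`infinite_setOf_prime_absNorm_frobenius_eq_of_not_mem_adjoinRootsOfUnity`).
[cite: DeligneSerreASENS1974, 6.12] [cite: ACCGHLNSTT2023, §1 (Notation: ρ̄)] -/
theorem isOpen_ker_of_isResidualRepOf {ρ : FramedGaloisRep K (PadicAlgCl ℓ) n}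
    {ι : padicAlgClResidueField ℓ →+* k} {τ : absoluteGaloisGroup K →* GL (Fin n) k}
    (h : ρ.IsResidualRepOf ι τ) : IsOpen (τ.ker : Set (absoluteGaloisGroup K)) := by
  obtain ⟨τ₀, h₀, hss⟩ := h
  exact Subgroup.isOpen_mono hss.2.2 (isOpen_ker_of_isReductionOf h₀)

end FramedGaloisRep

end PadicAlgCl

end Literature.NumberTheory.GaloisRepresentations

end
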